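/-
Copyright (c) 2026. All rights reserved.
Released under Apache 2.0 license as described in the file LICENSE.
Authors: HodgeCM publication cell (pub-hodgecm), model-construction sub-cell, construction prover `mc-weil-1`.
-/
import Literature.RepresentationTheory.HeisenbergGroup.LocalWeilProjective

/-!
# The Siegel-parabolic and Weyl generators inside `Sp(W)` and their lifts to `S̃p_ψ(W)`

Topic `RepresentationTheory/HeisenbergGroup`; namespace `Literature.RepresentationTheory.HeisenbergGroup`.

KERNEL throughout; no records. For `2` invertible:
* §1 `toSp B s ∈ symplecticGroup B` (the linear part of a pseudosymplectic element) and the criterion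
  `ofSymplectic B (toSp B s) = s` iff `s.f` is Weil's quadratic `f_σ(w) = ½(B(σw,σw) - B(w,w))` (`ofSymplectic_toSp`);
  for `B = polar β` the elements of `Sp(W)`: `leviSp β a d` (`m(a)`, with `β(ax,dy) = β(x,y)`), `unipotentSp β b`
  (`n(b)`, `b : X →ₗ Y` SYMMETRIC: `β(x, b x') = β(x', b x)`), `weylSp β γ δ` (`w`), with
  `ofSymplectic (leviSp …) = leviElt …`, `ofSymplectic (unipotentSp b hb) = unipotentElt β b (x ↦ ½β(x,bx)) _`,
  `ofSymplectic (weylSp …) = weylElt …` (Weil n° 5–6; MVW II.6 `P(X) = M N`);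
* §2 the Schwartz–Bruhat-level operators as linear AUTOMORPHISMS of `𝒮(X)`: `restrictSB` (restriction of an
  automorphism of `X → ℂ` preserving `𝒮(X)` both ways), `leviEquivSB`, `unipotentEquivSB`, and the transfer
  `restrictSB_mem_mpPairs : (s, M) ∈ mpPairs (schrodinger β ψ) → (s, restrictSB M …) ∈ mpPairs (schrodingerSB β ψ …)`;
* §3 the three memberships IN `MpPsi (schrodingerSB β ψ …)` (the interface asked for by node W2):
  `levi_mem_MpPsi : (leviSp β a d had, leviEquivSB …) ∈ MpPsi _`, `unipotent_mem_MpPsi`, and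
  `weyl_mem_MpPsi : (weylSp β γ δ hγδ, weylEquivSB …) ∈ MpPsi _` (the last with the two explicit hypotheses (i), (ii) of
  `SchrodingerWeylElement.lean`); consequently `ExistsImplementer` holds KERNEL on the subgroup of `Sp(W)` generated by
  these elements (`existsImplementer_of_mem_closure`), i.e. on all of `Sp(W)` wherever generation is proved
  (rank one: `RankOneGeneration.lean`).
-/

set_option autoImplicit false

noncomputable section

namespace Literature.RepresentationTheory.HeisenbergGroup

open _root_.MeasureTheory
open Literature.NumberTheory.Automorphic (SchwartzBruhat mem_schwartzBruhat_iff)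

universe u v w

/-! ## §1 Generators in `Sp(W)` -/

section ToSp

variable {R : Type u} [CommRing R] {V : Type v} [AddCommGroup V] [Module R V] (B : V →ₗ[R] V →ₗ[R] R)

/-- the linear part of a pseudosymplectic element, as an element of `Sp(alt B)`. [cite: Weil1964, n° 5, p. 150] -/
def toSp (s : Heisenberg.PseudoSymplectic B) : symplecticGroup B :=
  ⟨Heisenberg.PseudoSymplectic.toGL s, toGL_mem_symplecticGroup B s⟩

/-- formula. [cite: Weil1964, n° 5, p. 150] -/
@[simp] theorem coe_toSp (s : Heisenberg.PseudoSymplectic B) : ((toSp B s : symplecticGroup B) : V ≃ₗ[R] V) = s.σ := rfl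

/-- `toSp ∘ ofSymplectic = id`. [cite: Weil1964, n° 5, pp. 150–151] -/
@[simp] theorem toSp_ofSymplectic [Invertible (2 : R)] (g : symplecticGroup B) : toSp B (ofSymplectic B g) = g := rfl

/-- **criterion**: `ofSymplectic (toSp s) = s` as soon as `s.f` is Weil's quadratic form `½(B(σw,σw) - B(w,w))`.
[cite: Weil1964, n° 5, pp. 150–151] -/
theorem ofSymplectic_toSp [Invertible (2 : R)] (s : Heisenberg.PseudoSymplectic B)
    (hf : ∀ w, s.f w = ⅟(2 : R) * (B (s.σ w) (s.σ w) - B w w)) : ofSymplectic B (toSp B s) = s := by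
  ext w
  · rfl
  · rw [ofSymplectic_f, hf]; rfl

end ToSp

section SiegelSp

variable {R : Type u} [CommRing R] {X : Type v} {Y : Type w} [AddCommGroup X] [Module R X] [AddCommGroup Y] [Module R Y]
  (β : X →ₗ[R] Y →ₗ[R] R)

/-- the Levi element `m(a, d) ∈ Sp(W)`, `(x,y) ↦ (a x, d y)` with `β(ax, dy) = β(x,y)`. [cite: Weil1964, n° 6, p. 151] -/
def leviSp (a : X ≃ₗ[R] X) (d : Y ≃ₗ[R] Y) (had : ∀ x y, β (a x) (d y) = β x y) : symplecticGroup (polar β) :=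
  toSp (polar β) (leviElt β a d had)

/-- underlying map of `m(a, d)`. [cite: Weil1964, n° 6, p. 151] -/
@[simp] theorem coe_leviSp_apply (a : X ≃ₗ[R] X) (d : Y ≃ₗ[R] Y) (had : ∀ x y, β (a x) (d y) = β x y) (p : X × Y) :
    ((leviSp β a d had : symplecticGroup (polar β)) : (X × Y) ≃ₗ[R] (X × Y)) p = (a p.1, d p.2) := by
  show (leviElt β a d had).σ p = _
  rw [leviElt_σ]

/-- the Weyl element `w(γ, δ) ∈ Sp(W)`, `(x,y) ↦ (γ y, δ x)` with `β(γy, δx) = -β(x,y)`. [cite: Weil1964, n° 6, p. 151] -/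
def weylSp (γ : Y ≃ₗ[R] X) (δ : X ≃ₗ[R] Y) (hγδ : ∀ (x : X) (y : Y), β (γ y) (δ x) = -β x y) :
    symplecticGroup (polar β) :=
  toSp (polar β) (weylElt β γ δ hγδ)

/-- underlying map of `w(γ, δ)`. [cite: Weil1964, n° 6, p. 151] -/
@[simp] theorem coe_weylSp (γ : Y ≃ₗ[R] X) (δ : X ≃ₗ[R] Y) (hγδ : ∀ (x : X) (y : Y), β (γ y) (δ x) = -β x y) :
    ((weylSp β γ δ hγδ : symplecticGroup (polar β)) : (X × Y) ≃ₗ[R] (X × Y)) = weylσ γ δ := rfl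

variable [Invertible (2 : R)]

/-- Weil's section on a Levi element is the Levi pseudosymplectic element (`f = 0`). [cite: Weil1964, n° 6, p. 151] -/
@[simp] theorem ofSymplectic_leviSp (a : X ≃ₗ[R] X) (d : Y ≃ₗ[R] Y) (had : ∀ x y, β (a x) (d y) = β x y) :
    ofSymplectic (polar β) (leviSp β a d had) = leviElt β a d had :=
  ofSymplectic_toSp _ _ fun w => by simp [leviElt_f, leviElt_σ, polar_apply, had]

/-- Weil's quadratic datum of a symmetric `b : X →ₗ Y`: `q_b(x) = ½ β(x, b x)` satisfies the second-degree identity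
`q(x+x') = q x + q x' + β(x, b x')`. [cite: Weil1964, n° 6, p. 151] -/
theorem secondDegree_half (b : X →ₗ[R] Y) (hb : ∀ x x', β x (b x') = β x' (b x)) (x x' : X) :
    ⅟(2 : R) * β (x + x') (b (x + x')) = ⅟(2 : R) * β x (b x) + ⅟(2 : R) * β x' (b x') + β x (b x') := by
  have h2 : ⅟(2 : R) * 2 = 1 := invOf_mul_self _
  simp only [map_add, LinearMap.add_apply]
  linear_combination (⅟(2 : R)) * (hb x' x) + (β x (b x')) * h2

/-- the unipotent element `n(b) ∈ Sp(W)`, `(x,y) ↦ (x, y + b x)` for `b` SYMMETRIC. [cite: Weil1964, n° 6, p. 151] -/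
def unipotentSp (b : X →ₗ[R] Y) (hb : ∀ x x', β x (b x') = β x' (b x)) : symplecticGroup (polar β) :=
  toSp (polar β) (unipotentElt β b (fun x => ⅟(2 : R) * β x (b x)) (secondDegree_half β b hb))

/-- underlying map of `n(b)`. [cite: Weil1964, n° 6, p. 151] -/
@[simp] theorem coe_unipotentSp (b : X →ₗ[R] Y) (hb : ∀ x x', β x (b x') = β x' (b x)) :
    ((unipotentSp β b hb : symplecticGroup (polar β)) : (X × Y) ≃ₗ[R] (X × Y)) = unipotentσ b := rfl

/-- Weil's section on `n(b)` is the unipotent pseudosymplectic element with `q = ½β(x, bx)`. [cite: Weil1964, n° 6, p. 151] -/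
@[simp] theorem ofSymplectic_unipotentSp (b : X →ₗ[R] Y) (hb : ∀ x x', β x (b x') = β x' (b x)) :
    ofSymplectic (polar β) (unipotentSp β b hb)
      = unipotentElt β b (fun x => ⅟(2 : R) * β x (b x)) (secondDegree_half β b hb) :=
  ofSymplectic_toSp _ _ fun w => by
    simp only [unipotentElt_f, unipotentElt_σ, polar_apply, map_add, mul_sub]
    ring

/-- Weil's section on the Weyl element is `d₀'(γ, δ)` (`f(x,y) = -β x y`). [cite: Weil1964, n° 6, p. 151] -/
@[simp] theorem ofSymplectic_weylSp (γ : Y ≃ₗ[R] X) (δ : X ≃ₗ[R] Y)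
    (hγδ : ∀ (x : X) (y : Y), β (γ y) (δ x) = -β x y) :
    ofSymplectic (polar β) (weylSp β γ δ hγδ) = weylElt β γ δ hγδ :=
  ofSymplectic_toSp _ _ fun w => by
    have h2 : ⅟(2 : R) * 2 = 1 := invOf_mul_self _
    simp only [weylElt_f, weylElt_σ, polar_apply, hγδ]
    linear_combination (β w.1 w.2) * h2

end SiegelSp

/-! ## §2 Schwartz–Bruhat-level automorphisms -/

section Restrict

variable {X : Type v} [TopologicalSpace X]

/-- restriction of a linear automorphism `M` of `X → ℂ` preserving `𝒮(X)` in both directions to a linear automorphism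
of `𝒮(X)`. [folklore] -/
def restrictSB (M : (X → ℂ) ≃ₗ[ℂ] (X → ℂ)) (hM : ∀ f ∈ SchwartzBruhat X, M f ∈ SchwartzBruhat X)
    (hM' : ∀ f ∈ SchwartzBruhat X, M.symm f ∈ SchwartzBruhat X) : SchwartzBruhat X ≃ₗ[ℂ] SchwartzBruhat X where
  toFun f := ⟨M f, hM f f.2⟩
  map_add' f g := Subtype.ext (M.map_add f g)
  map_smul' c f := Subtype.ext (M.map_smul c f)
  invFun f := ⟨M.symm f, hM' f f.2⟩
  left_inv f := Subtype.ext (M.symm_apply_apply (f : X → ℂ))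
  right_inv f := Subtype.ext (M.apply_symm_apply (f : X → ℂ))

/-- formula. [folklore] -/
@[simp] theorem coe_restrictSB (M : (X → ℂ) ≃ₗ[ℂ] (X → ℂ)) (hM : ∀ f ∈ SchwartzBruhat X, M f ∈ SchwartzBruhat X)
    (hM' : ∀ f ∈ SchwartzBruhat X, M.symm f ∈ SchwartzBruhat X) (f : SchwartzBruhat X) :
    ((restrictSB M hM hM' f : SchwartzBruhat X) : X → ℂ) = M f := rfl

end Restrict

section Inverses

variable {R : Type u} [CommRing R] {X : Type v} (ψ : AddChar R Circle)

/-- the inverse of the unipotent operator is multiplication by `ψ(q ·)`. [cite: Weil1964, n° 13, p. 160] -/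
theorem unipotentOp_symm_apply (q : X → R) (f : X → ℂ) (u : X) :
    (unipotentOp ψ q).symm f u = (ψ (q u) : ℂ) * f u := by
  show (((ψ (-q u))⁻¹ : Circle) : ℂ) * f u = _
  rw [AddChar.map_neg_eq_inv, inv_inv]

variable [AddCommGroup X] [Module R X]

/-- the inverse of the Levi operator is the Levi operator of the inverse. [cite: Weil1964, n° 13, p. 160] -/
theorem leviOp_symm_apply (a : X ≃ₗ[R] X) (f : X → ℂ) (u : X) : (leviOp a).symm f u = f (a u) := rfl

end Inverses

section LeviSB

variable {R : Type u} [CommRing R] {X : Type v} [AddCommGroup X] [Module R X] [TopologicalSpace X]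

/-- **Levi operator on `𝒮(X)`**: `f ↦ f ∘ a⁻¹` as a linear automorphism of `𝒮(X)` (`a`, `a⁻¹` continuous).
[cite: Weil1964, n° 13, p. 160] -/
def leviEquivSB (a : X ≃ₗ[R] X) (ha : Continuous a) (ha' : Continuous a.symm) :
    SchwartzBruhat X ≃ₗ[ℂ] SchwartzBruhat X :=
  restrictSB (leviOp a) (fun _ hf => leviOp_mem_schwartzBruhat a ha ha' hf) fun f hf => by
    have e : (leviOp a).symm f = leviOp a.symm f := by
      funext u; rw [leviOp_symm_apply, leviOp_apply]; rfl
    rw [e]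
    exact leviOp_mem_schwartzBruhat a.symm ha' ha hf

/-- formula. [cite: Weil1964, n° 13, p. 160] -/
@[simp] theorem coe_leviEquivSB (a : X ≃ₗ[R] X) (ha : Continuous a) (ha' : Continuous a.symm) (f : SchwartzBruhat X) :
    ((leviEquivSB a ha ha' f : SchwartzBruhat X) : X → ℂ) = leviOp a f := rfl

end LeviSB

section UnipotentSB

variable {R : Type u} [CommRing R] {X : Type v} (ψ : AddChar R Circle) [TopologicalSpace X] [TopologicalSpace R]
  [ContinuousNeg R]

/-- **unipotent operator on `𝒮(X)`**: multiplication by `ψ(-q ·)` as a linear automorphism of `𝒮(X)` (`ψ` locally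
constant, `q` continuous). [cite: Weil1964, n° 13, p. 160] -/
def unipotentEquivSB (hψ : IsLocallyConstant (⇑ψ : R → Circle)) (q : X → R) (hq : Continuous q) :
    SchwartzBruhat X ≃ₗ[ℂ] SchwartzBruhat X :=
  restrictSB (unipotentOp ψ q) (fun _ hf => unipotentOp_mem_schwartzBruhat ψ hψ q hq hf) fun f hf => by
    have e : (unipotentOp ψ q).symm f = unipotentOp ψ (-q) f := by
      funext u; rw [unipotentOp_symm_apply, unipotentOp_apply, Pi.neg_apply, neg_neg]
    rw [e]
    exact unipotentOp_mem_schwartzBruhat ψ hψ (-q) hq.neg hf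

/-- formula. [cite: Weil1964, n° 13, p. 160] -/
@[simp] theorem coe_unipotentEquivSB (hψ : IsLocallyConstant (⇑ψ : R → Circle)) (q : X → R) (hq : Continuous q)
    (f : SchwartzBruhat X) : ((unipotentEquivSB ψ hψ q hq f : SchwartzBruhat X) : X → ℂ) = unipotentOp ψ q f := rfl

end UnipotentSB

section Transfer

variable {R : Type u} [CommRing R] {X : Type v} {Y : Type w} [AddCommGroup X] [Module R X] [AddCommGroup Y]
  [Module R Y] (β : X →ₗ[R] Y →ₗ[R] R) (ψ : AddChar R Circle)
variable [TopologicalSpace X] [TopologicalSpace R] [IsTopologicalAddGroup X]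

/-- **transfer of (A) from functions to `𝒮(X)`**: if `(s, M)` satisfies (A) for `schrodinger β ψ`, then
`(s, restrictSB M)` satisfies (A) for `schrodingerSB β ψ`. [cite: MoeglinVignerasWaldspurger1987, Chap. 2 II.1 (A)] -/
theorem restrictSB_mem_mpPairs (hψ : IsLocallyConstant (⇑ψ : R → Circle))
    (hβ : ∀ y : Y, Continuous fun u : X => β u y) (s : Heisenberg.PseudoSymplectic (polar β))
    (M : (X → ℂ) ≃ₗ[ℂ] (X → ℂ)) (hM : ∀ f ∈ SchwartzBruhat X, M f ∈ SchwartzBruhat X)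
    (hM' : ∀ f ∈ SchwartzBruhat X, M.symm f ∈ SchwartzBruhat X) (h : (s, M) ∈ mpPairs (schrodinger β ψ)) :
    (s, restrictSB M hM hM') ∈ mpPairs (schrodingerSB β ψ hψ hβ) := by
  rw [mem_mpPairs] at h ⊢
  intro hh f
  apply Subtype.ext
  rw [coe_restrictSB, coe_schrodingerSB, coe_schrodingerSB, coe_restrictSB]
  exact h hh f

end Transfer

/-! ## §3 The memberships in `MpPsi (schrodingerSB β ψ …)` -/

section Memberships

variable {R : Type u} [CommRing R] [Invertible (2 : R)] {X : Type v} {Y : Type w} [AddCommGroup X] [Module R X]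
  [AddCommGroup Y] [Module R Y] (β : X →ₗ[R] Y →ₗ[R] R) (ψ : AddChar R Circle)
variable [TopologicalSpace X] [TopologicalSpace R] [IsTopologicalAddGroup X]

/-- **`(m(a,d), leviEquivSB a) ∈ S̃p_ψ(W)`** for the smooth Schrödinger model. [cite: MoeglinVignerasWaldspurger1987, Chap. 2 II.6] -/
theorem levi_mem_MpPsi (hψ : IsLocallyConstant (⇑ψ : R → Circle)) (hβ : ∀ y : Y, Continuous fun u : X => β u y)
    (a : X ≃ₗ[R] X) (d : Y ≃ₗ[R] Y) (had : ∀ x y, β (a x) (d y) = β x y) (ha : Continuous a)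
    (ha' : Continuous a.symm) :
    (leviSp β a d had, leviEquivSB a ha ha') ∈ MpPsi (schrodingerSB β ψ hψ hβ) := by
  rw [mem_MpPsi, ofSymplectic_leviSp]
  exact restrictSB_mem_mpPairs β ψ hψ hβ _ _ _ _ (levi_mem_mpPairs β ψ a d had)

section Unipotent

variable [ContinuousNeg R]

/-- **`(n(b), unipotentEquivSB (½β(·, b·))) ∈ S̃p_ψ(W)`** for `b` symmetric with `x ↦ β(x, bx)` continuous.
[cite: MoeglinVignerasWaldspurger1987, Chap. 2 II.6] -/
theorem unipotent_mem_MpPsi (hψ : IsLocallyConstant (⇑ψ : R → Circle)) (hβ : ∀ y : Y, Continuous fun u : X => β u y)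
    (b : X →ₗ[R] Y) (hb : ∀ x x', β x (b x') = β x' (b x)) (hq : Continuous fun x : X => ⅟(2 : R) * β x (b x)) :
    (unipotentSp β b hb, unipotentEquivSB ψ hψ (fun x => ⅟(2 : R) * β x (b x)) hq)
      ∈ MpPsi (schrodingerSB β ψ hψ hβ) := by
  rw [mem_MpPsi, ofSymplectic_unipotentSp]
  exact restrictSB_mem_mpPairs β ψ hψ hβ _ _ _ _ (unipotent_mem_mpPairs β ψ b _ (secondDegree_half β b hb))

end Unipotent

section Weyl

variable [MeasurableSpace X] (μ : Measure X) [OpensMeasurableSpace X] [IsFiniteMeasureOnCompacts μ] [MeasurableAdd X]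
  [μ.IsAddRightInvariant]

/-- **`(w(γ,δ), weylEquivSB) ∈ S̃p_ψ(W)`** under the two explicit hypotheses (i) stability, (ii) inversion of
`SchrodingerWeylElement.lean`. [cite: MoeglinVignerasWaldspurger1987, Chap. 2 II.6] -/
theorem weyl_mem_MpPsi (hψ : IsLocallyConstant (⇑ψ : R → Circle)) (hβ : ∀ w : Y, Continuous fun v : X => β v w)
    (γ : Y ≃ₗ[R] X) (δ : X ≃ₗ[R] Y) (hγδ : ∀ (x : X) (y : Y), β (γ y) (δ x) = -β x y)
    (hW : ∀ f : SchwartzBruhat X, weylFun β ψ μ γ f ∈ SchwartzBruhat X) (c : ℂˣ)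
    (hinv : ∀ f : SchwartzBruhat X,
      weylFun β ψ μ γ (weylFun β ψ μ γ f) = (c : ℂ) • fun u => (f : X → ℂ) (-u)) :
    (weylSp β γ δ hγδ, weylEquivSB β ψ μ γ hψ hβ hW c hinv) ∈ MpPsi (schrodingerSB β ψ hψ hβ) := by
  rw [mem_MpPsi, ofSymplectic_weylSp]
  exact weylPair_mem_mpPairs β ψ μ γ δ hψ hβ hW c hinv hγδ

end Weyl

end Memberships

/-! ## §4 Existence of implementers on a generated subgroup -/

section Closure

variable {R : Type u} [CommRing R] [Invertible (2 : R)] {V : Type v} [AddCommGroup V] [Module R V]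
  {B : V →ₗ[R] V →ₗ[R] R}
variable {k : Type*} [CommRing k] {S : Type*} [AddCommGroup S] [Module k S]
variable (ρ : Representation k (Heisenberg B) S)

/-- the set of `g ∈ Sp(W)` admitting an implementer is the range of `p : MpPsi ρ → Sp(W)`, a subgroup; hence
implementers exist on the subgroup GENERATED by any set of implemented elements. [cite: MoeglinVignerasWaldspurger1987, Chap. 2 II.1 (B)] -/
theorem exists_implementer_of_mem_closure (T : Set (symplecticGroup B))
    (hT : ∀ g ∈ T, ∃ M : S ≃ₗ[k] S, Implements ρ (ofSymplectic B g) M) {g : symplecticGroup B}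
    (hg : g ∈ Subgroup.closure T) : ∃ M : S ≃ₗ[k] S, Implements ρ (ofSymplectic B g) M := by
  have hsub : Subgroup.closure T ≤ (MpPsi.proj ρ).range := by
    rw [Subgroup.closure_le]
    intro g hg
    obtain ⟨M, hM⟩ := hT g hg
    exact ⟨⟨(g, M), hM⟩, rfl⟩
  obtain ⟨x, hx⟩ := hsub hg
  refine ⟨(x : symplecticGroup B × (S ≃ₗ[k] S)).2, ?_⟩
  have := x.2
  rw [mem_MpPsi] at this
  rw [MpPsi.proj_apply] at hx
  rwa [hx] at this

/-- **`ExistsImplementer` from generation**: if `Sp(W)` is generated by implemented elements, every `g` is implemented.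
[cite: MoeglinVignerasWaldspurger1987, Chap. 2 II.1 (B)] -/
theorem existsImplementer_of_closure_eq_top (T : Set (symplecticGroup B))
    (hT : ∀ g ∈ T, ∃ M : S ≃ₗ[k] S, Implements ρ (ofSymplectic B g) M) (htop : Subgroup.closure T = ⊤) :
    ExistsImplementer ρ := fun g =>
  exists_implementer_of_mem_closure ρ T hT (by rw [htop]; exact Subgroup.mem_top g)

end Closure

end Literature.RepresentationTheory.HeisenbergGroup
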